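import Summits.QuantumFields.BalabanUV.T4Continuum.Support.GradedSubBlocks
import Summits.QuantumFields.BalabanUV.T4Continuum.Support.ScalarPlantingDefect

/-!
# T⁴ programme, spine node NE2 (U1a), sub-row Δ1 — THE GRADED WELL, file 1b: MEANS OF MEANS across two scales `t ∣ s` on one torus
# (the anchor of a site; `Σ_{y∈B_s(z)} g = Σ_{t-anchors w ∈ B_s(z)} Σ_{y∈B_t(w)} g`; a sub-block lies in one unit block)

Row NE2 OWNER (unit `b2b-balaban-t4-ne2-p1`, gen 16), item O16-c (part 1) of RULING R47 (journal 2026-08-21 l.25022), on file 1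
`Support/GradedSubBlocks` (p244783).  The refinement combinatorics behind [Balaban1984PropagatorsII] (2.7) «λ = 0 on Λ₀, Q′_jλ = 0 on Λ_j»:
vanishing of the FINER sub-block means forces vanishing of every COARSER mean — used in file 3 (`Support/GradedWellSlice`) to show that
the graded vector averaging kills the gradients of `N(Q′_GW)` (the `avg_grad` field of `SliceData`).

 * `anchorOf N t y` (coordinates `⌊y_ν/t⌋·t`), `val_anchorOf`, `inSub_anchorOf`, `eq_anchorOf_of_inSub`, `sum_anchor_inSub` (a sum over
   `t`-anchors against `[y ∈ B_t(w)]` picks the anchor of `y`), `div_mul_div_eq`, `inSub_anchorOf_iff` (for `t ∣ s`: the `t`-anchor of `y`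
   lies in `B_s(z)` iff `y` does), **`sum_inSub_refine`**; and on `Tor (fine n M)`: **`blockOf_eq_of_inSub`** (`s ∣ n`: a scale-`s` sub-block
   lies in ONE unit block).

HONEST FRAMING (T4-DAG p. 1).  [folklore] finite-torus combinatorics; no estimate; NE2 (U1a) NOT proved; spine PROVED 0/9 unchanged; NOT [B9]
(3.16)/(3.23)–(3.27) as printed; NOT infinite volume / mass gap / Clay.  HONEST DEPENDENCY: continuum YM on T⁴ ⇐ BetaPertH ∧ nine spine
estimates (0/9 proved); BetaPertH ⇐ (D1) ∧ (D4) ∧ CAP+tail; G-an2-4 gates asym, D1 and NE2/3/4.  No `sorry`.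
-/

noncomputable section

open scoped BigOperators ComplexConjugate Matrix
open Finset

namespace Summit.QuantumFields.BalabanUV.T4Continuum.GradedSubBlocksRefine

open Literature.MathematicalPhysics.QuantumFieldTheory.Balaban1983to89.B5Prop11Plancherel (Tor fine)
open Literature.MathematicalPhysics.QuantumFieldTheory.Balaban1983to89.B5Blocks16 (blockOf)
open Summit.QuantumFields.BalabanUV.T4Continuum
open Summit.QuantumFields.BalabanUV.T4Continuum.ScalarPlantingDefect (val_blockOf)
open Summit.QuantumFields.BalabanUV.T4Continuum.GradedSubBlocks (Anchor Anc InSub s_pos anchor_eq_of_inSub)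

variable {d : ℕ}

/-! ## §1 Means of means: the anchor of a site, refinement of sub-block sums across two scales -/

section Refine

variable (N : Fin d → ℕ) [hN : ∀ ν, NeZero (N ν)] (s t : ℕ) [NeZero s] [NeZero t]

/-- the scale-`t` ANCHOR of a site: coordinates `⌊y_ν/t⌋·t`. [folklore] -/
def anchorOf (y : Tor N) : Anc N t :=
  ⟨fun ν => ((((y ν).val / t) * t : ℕ) : ZMod (N ν)), fun ν => by
    have hlt : (y ν).val / t * t < N ν := lt_of_le_of_lt (Nat.div_mul_le_self _ _) (ZMod.val_lt _)
    show t ∣ ((((y ν).val / t * t : ℕ) : ZMod (N ν))).val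
    rw [ZMod.val_cast_of_lt hlt]
    exact Dvd.intro_left _ rfl⟩

omit [NeZero t] in
/-- the coordinate values of the anchor: `⌊y_ν/t⌋·t`. [folklore] -/
theorem val_anchorOf (y : Tor N) (ν : Fin d) : ((anchorOf N t y).1 ν).val = (y ν).val / t * t := by
  have hlt : (y ν).val / t * t < N ν := lt_of_le_of_lt (Nat.div_mul_le_self _ _) (ZMod.val_lt _)
  show ((((y ν).val / t * t : ℕ) : ZMod (N ν))).val = _
  rw [ZMod.val_cast_of_lt hlt]

/-- a site lies in the sub-block of its anchor. [folklore] -/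
theorem inSub_anchorOf (y : Tor N) : InSub N t (anchorOf N t y).1 y := by
  intro ν
  rw [val_anchorOf, Nat.mul_div_cancel _ (s_pos t)]

/-- the anchor of the sub-block containing `y` is unique. [folklore] -/
theorem eq_anchorOf_of_inSub {w : Anc N t} {y : Tor N} (h : InSub N t w.1 y) : w = anchorOf N t y :=
  Subtype.ext (anchor_eq_of_inSub N t w.2 (anchorOf N t y).2 fun ν => by
    rw [val_anchorOf, Nat.mul_div_cancel _ (s_pos t)]; exact h ν)

/-- a sum over `t`-anchors against `[y ∈ B_t(w)]` picks the anchor of `y`. [folklore] -/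
theorem sum_anchor_inSub (y : Tor N) (F : Anc N t → ℂ) :
    ∑ w : Anc N t, (if InSub N t w.1 y then F w else 0) = F (anchorOf N t y) := by
  rw [Finset.sum_eq_single (anchorOf N t y)]
  · rw [if_pos (inSub_anchorOf N t y)]
  · intro w _ hw
    rw [if_neg]
    intro h
    exact hw (eq_anchorOf_of_inSub N t h)
  · intro h; exact absurd (Finset.mem_univ _) h

omit hN [NeZero s] in
/-- for `t ∣ s`: `⌊(⌊a/t⌋·t)/s⌋ = ⌊a/s⌋`. [folklore] -/
theorem div_mul_div_eq (hts : t ∣ s) (a : ℕ) : a / t * t / s = a / s := by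
  obtain ⟨r, hr⟩ := hts
  rw [hr, ← Nat.div_div_eq_div_mul, ← Nat.div_div_eq_div_mul, Nat.mul_div_cancel _ (s_pos t)]

omit [NeZero s] in
/-- for `t ∣ s`: the `t`-anchor of `y` lies in `B_s(z)` iff `y` does. [folklore] -/
theorem inSub_anchorOf_iff (hts : t ∣ s) (z y : Tor N) : InSub N s z (anchorOf N t y).1 ↔ InSub N s z y := by
  constructor
  · intro h ν
    have h1 := h ν
    rw [val_anchorOf, div_mul_div_eq s t hts] at h1
    exact h1
  · intro h ν
    rw [val_anchorOf, div_mul_div_eq s t hts]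
    exact h ν

omit [NeZero s] in
/-- **MEANS OF MEANS**: for `t ∣ s`, `Σ_{y∈B_s(z)} g(y) = Σ_{w : t-anchors} [w ∈ B_s(z)]·Σ_{y∈B_t(w)} g(y)` — a scale-`s` sub-block is the
disjoint union of the scale-`t` sub-blocks of the `t`-anchors it contains. [cite: Balaban1984PropagatorsII, (2.7) p.225 (shape)] [folklore] -/
theorem sum_inSub_refine (hts : t ∣ s) (z : Tor N) (g : Tor N → ℂ) :
    ∑ y, (if InSub N s z y then g y else 0)
      = ∑ w : Anc N t, (if InSub N s z w.1 then ∑ y, (if InSub N t w.1 y then g y else 0) else 0) := by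
  have e1 : ∀ w : Anc N t, (if InSub N s z w.1 then ∑ y, (if InSub N t w.1 y then g y else 0) else 0)
      = ∑ y, (if InSub N t w.1 y then (if InSub N s z w.1 then g y else 0) else 0) := by
    intro w
    split_ifs with h
    · rfl
    · simp
  simp_rw [e1]
  rw [Finset.sum_comm]
  refine Finset.sum_congr rfl fun y _ => ?_
  rw [sum_anchor_inSub N t y (fun w => if InSub N s z w.1 then g y else 0)]
  simp only [inSub_anchorOf_iff N s t hts]

end Refine

section Blocks

variable (n : ℕ) [NeZero n] (M : Fin d → ℕ) [hM : ∀ μ, NeZero (M μ)] (s : ℕ) [NeZero s]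

omit [NeZero s] in
/-- a scale-`s` sub-block (`s ∣ n`) lies in ONE unit block: `y ∈ B_s(z) → blockOf y = blockOf z`. [folklore] -/
theorem blockOf_eq_of_inSub (hsn : s ∣ n) {z y : Tor (fine n M)} (h : InSub (fine n M) s z y) :
    blockOf n M y = blockOf n M z := by
  obtain ⟨r, hr⟩ := hsn
  funext ν
  apply ZMod.val_injective
  have e1 : (y ν).val / n = (y ν).val / s / r := by rw [Nat.div_div_eq_div_mul, ← hr]
  have e2 : (z ν).val / n = (z ν).val / s / r := by rw [Nat.div_div_eq_div_mul, ← hr]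
  rw [val_blockOf, val_blockOf, e1, e2, h ν]

end Blocks

end Summit.QuantumFields.BalabanUV.T4Continuum.GradedSubBlocksRefine

end
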